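import Summits.HodgeConjecture.CorCM.GaloisSplitInvolutionTypes
import HarnessLib

/-!
# `SD₁₆ × C_n`, `M₁₆ × C_n` (every `n ≥ 1`) and `D₈ × C_n` (`n ≥ 3`) are BAD: doubled interval types under the split involution

COR-CM (cell `pub-hodgecm2`), binder seat b04 (gen 29), count-neutral own lane «Galois-CM-type classification» (which Galois CM
fields `(G, c)` have ALL primitive CM types nondegenerate = GOOD, vs. a primitive degenerate type = BAD).  KERNEL ONLY: theorems;
no definition, no named fact, no `sorry`.  `HC_CM` is neither used nor claimed.

SETTING.  The three non-abelian groups of order `16` with a cyclic subgroup `⟨α⟩ ≅ ℤ/8` and a SPLIT involution `ξ` outside it,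
`ξ α ξ⁻¹ = αᵘ`: `u = 3` semidihedral `SD₁₆`, `u = 5` modular `M₁₆`, `u = 7` dihedral `D₈` — presented uniformly as
`ℤ/8 ⋊_u C₂ = Multiplicative (ZMod 8) ⋊[φ] Multiplicative (ZMod 2)` with `φ(1) = (·)ᵘ` — times a cyclic group `C_n`, complex
conjugation `c = (α⁴, 1)` (the unique central involution of `SD₁₆`/`M₁₆`… times `1`).  This is the situation of the
SPLIT-INVOLUTION THEOREM (`CorCM/GaloisSplitInvolutionTypes`, `exists_simple_degenerate_of_split_involution`): `A = ℤ/8 × ℤ/n` abelian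
of index `2`, `x = (ξ, 1)` with `x² = 1`, `θ = (u·, id)`, `c ∈ A` with `θ c = c`; the DOUBLED TYPE `T = S ⊔ S x` of a half `S ⊂ A`
has every odd two-sheet block singular, hence is DEGENERATE, and it is PRIMITIVE iff `S` is aperiodic and `θ`-asymmetric.
THE HALF: `S = {(t, v) : t − 𝟙_{v=1}(v) ∈ I₀}`, `I₀ = {0,1,2,3} ⊂ ℤ/8` (fibres: the interval `I₀`, shifted by `1` over `v = 1`).
* §1 (`decide` in `ℤ/8`): `I₀ + e = I₀ ⟺ e = 0`; `u I₀ + e ≠ I₀` for `u = 3, 5` and all `e`; `−I₀ + e = I₀ ⟺ e = 3`; `I₀ + 4 = I₀ᶜ`.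
* §2 (symbolic in `n`): `S` is a CM half (`half8_cm`), APERIODIC for every `n ≥ 1` (`half8_aperiodic`: a period `(a₁, a₂)` forces
  `a₁ + 𝟙(v) − 𝟙(a₂+v) = 0` for all `v`, so `a₁ = −1` at `v = 1` and `a₁ = 1` at `v = 1 − a₂` unless `a₂ = 0 = a₁`),
  `θ`-ASYMMETRIC for `u = 3, 5` and every `n` (`half8_asymmetric_mul`, already on the fibre `v = 0`) and for `u = 7 = −1` when
  `n ≥ 3` (`half8_asymmetric_neg`: `a₁ − 𝟙(v) − 𝟙(a₂+v) = 3` for all `v` is impossible with three distinct fibres).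
* §3 `exists_simple_degenerate_semidirectEight_times_cyclic_of_half`: the split-involution theorem for `(ℤ/8 ⋊_u C₂) × C_n`, any odd
  `u`, with the half supplied as a decidable predicate on `ℤ/8 × ℤ/n`.
* §4 THEOREMS: **`Gal(K/ℚ) ≅ SD₁₆ × C_n` or `M₁₆ × C_n` (`c = (α⁴,1)`), ANY `n ≥ 1` ⟹ BAD** (`…_semidihedral_or_modular_times_cyclic`;
  `n = 1` recovers gen 17/22's `SD₁₆`, `M₁₆`); **`Gal(K/ℚ) ≅ D₈ × C_n` (as `ℤ/8 ⋊₋₁ C₂`, `c = (α⁴,1)`), `n ≥ 3` ⟹ BAD**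
  (`…_dihedralEight_times_cyclic`; `D₈` alone is GOOD, gen 16/22, and `n = 2` is the order-32 row `D₈ × C₂`, gen 23) — a simple
  DEGENERATE abelian variety of dimension `8n` with CM by `K` and an exceptional Hodge class on a power.  With
  `CorCM/GaloisDihedralTimesCyclicDegenerate` (`D₄ × C_n`, `n ≥ 3`) this settles the rows `Γ ∈ {D₄, D₈, SD₁₆, M₁₆}` of the
  «exceptional real factor `H = C_n`» table of gen 24 (`CorCM/GaloisRealFactorDegenerate`): all BAD.

## References

* [Kubota1965] T. Kubota, *On the field extension by complex multiplication*, Trans. AMS 118 (1965), §2, §4 Lemma 2.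
* [Shimura1998] G. Shimura, *Abelian Varieties with Complex Multiplication and Modular Functions*, §6.2 Thm. 3, §8.2 Prop. 26.
* [Gordon1999HodgeAVSurvey] B. B. Gordon, *A survey of the Hodge conjecture for abelian varieties*, Thm. 6.4, §9.3.
-/

noncomputable section

open CategoryTheory CategoryTheory.Limits NumberField
open scoped BigOperators

namespace Summit.HodgeConjecture.CorCM.SplitInvolution

open Literature.NumberTheory.ComplexMultiplication
open Literature.AlgebraicGeometry.Motives (AbelianVariety CMType)
open Literature.AlgebraicGeometry.HodgeTheory
open Literature.AlgebraicGeometry.ComplexMultiplication (IsCMTypeRealisation)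
open Literature.AlgebraicGeometry.Pohlmann1968
open Literature.Barriers.HodgeConjecture (divisorClassesSpan)

/-! ## §1 Interval facts in `ℤ/8` -/

section Interval

/-- `I₀ + e = I₀` in `ℤ/8` (`I₀ = {s : s.val < 4}`) iff `e = 0`. [folklore] -/
theorem forall_val_lt_four_iff_add (e : ZMod 8) : (∀ s : ZMod 8, (s.val < 4 ↔ (s + e).val < 4)) ↔ e = 0 := by
  revert e; decide

/-- `u I₀ + e ≠ I₀` in `ℤ/8` for `u = 3, 5` and every `e`. [folklore] -/
theorem not_forall_val_lt_four_iff_mul_add {u : ℕ} (hu : u = 3 ∨ u = 5) (e : ZMod 8) :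
    ¬ ∀ s : ZMod 8, (s.val < 4 ↔ ((u : ZMod 8) * s + e).val < 4) := by
  rcases hu with rfl | rfl <;> revert e <;> decide

/-- `−I₀ + e = I₀` in `ℤ/8` iff `e = 3`. [folklore] -/
theorem forall_val_lt_four_iff_neg_add (e : ZMod 8) : (∀ s : ZMod 8, (s.val < 4 ↔ (-s + e).val < 4)) ↔ e = 3 := by
  revert e; decide

/-- `I₀ + 4 = ℤ/8 ∖ I₀`. [folklore] -/
theorem val_lt_four_iff_not_add_four (s : ZMod 8) : s.val < 4 ↔ ¬ (s + 4).val < 4 := by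
  revert s; decide

end Interval

/-! ## §2 The half `S = {(t,v) : t − 𝟙_{v=1}(v) ∈ I₀}` of `ℤ/8 × ℤ/n`: CM, aperiodic, `θ`-asymmetric -/

section Half

variable {n : ℕ} [NeZero n]

omit [NeZero n] in
/-- **CM half**: `(t,v) ∈ S ↔ (t+4, v) ∉ S`. [folklore] -/
theorem half8_cm (s : ZMod 8 × ZMod n) :
    (s.1 - if s.2 = 1 then 1 else 0).val < 4 ↔ ¬ (((4, 0) + s).1 - if ((4, 0) + s).2 = 1 then 1 else 0).val < 4 := by
  obtain ⟨t, v⟩ := s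
  simp only [Prod.mk_add_mk, zero_add]
  have h : (4 + t - if v = 1 then (1 : ZMod 8) else 0) = (t - if v = 1 then (1 : ZMod 8) else 0) + 4 := by ring
  rw [h]
  exact val_lt_four_iff_not_add_four _

/-- **Aperiodic** (every `n ≥ 1`): no `a ≠ 0` with `P(a + s) ↔ P(s)` for all `s`. [folklore] -/
theorem half8_aperiodic (a : ZMod 8 × ZMod n) (ha : a ≠ 0) :
    ∃ s : ZMod 8 × ZMod n, ¬ ((s.1 - if s.2 = 1 then 1 else 0).val < 4 ↔
      ((a + s).1 - if (a + s).2 = 1 then 1 else 0).val < 4) := by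
  by_contra hcon
  push Not at hcon
  obtain ⟨a₁, a₂⟩ := a
  have key : ∀ v : ZMod n, a₁ + (if v = 1 then (1 : ZMod 8) else 0) - (if a₂ + v = 1 then (1 : ZMod 8) else 0) = 0 := by
    intro v
    rw [← forall_val_lt_four_iff_add]
    intro s
    have h := hcon (s + (if v = 1 then (1 : ZMod 8) else 0), v)
    simp only [Prod.mk_add_mk, add_sub_cancel_right] at h
    rw [h]
    have h' : (a₁ + (s + if v = 1 then (1 : ZMod 8) else 0) - if a₂ + v = 1 then (1 : ZMod 8) else 0) =
        s + (a₁ + (if v = 1 then (1 : ZMod 8) else 0) - if a₂ + v = 1 then (1 : ZMod 8) else 0) := by ring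
    rw [h']
  by_cases ha₂ : a₂ = 0
  · subst ha₂
    have h1 := key 1
    rw [zero_add, if_pos rfl, add_sub_cancel_right] at h1
    exact ha (by rw [h1]; rfl)
  · have hne : a₂ + 1 ≠ (1 : ZMod n) := fun h => ha₂ (by simpa using h)
    have h1a : (1 : ZMod n) - a₂ ≠ 1 := fun h => ha₂ (by simpa using h)
    have hsum : a₂ + (1 - a₂) = (1 : ZMod n) := by ring
    have h1 := key 1
    rw [if_pos rfl, if_neg hne, sub_zero] at h1
    have h2 := key (1 - a₂)
    rw [if_neg h1a, hsum, if_pos rfl, add_zero] at h2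
    have e1 : a₁ = -1 := by linear_combination h1
    have e2 : a₁ = 1 := by linear_combination h2
    exact absurd (e1.symm.trans e2) (by decide)

/-- **`θ`-asymmetric for `u = 3, 5`** (`θ(t,v) = (u t, v)`, every `n`): no `a` with `P(a + θ s) ↔ P(s)` for all `s` — already
refuted on the fibre `v = 0`. [folklore] -/
theorem half8_asymmetric_mul {u : ℕ} (hu : u = 3 ∨ u = 5) (a : ZMod 8 × ZMod n) :
    ∃ s : ZMod 8 × ZMod n, ¬ ((s.1 - if s.2 = 1 then 1 else 0).val < 4 ↔
      ((a + ((u : ZMod 8) * s.1, s.2)).1 - if (a + ((u : ZMod 8) * s.1, s.2)).2 = 1 then 1 else 0).val < 4) := by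
  by_contra hcon
  push Not at hcon
  obtain ⟨a₁, a₂⟩ := a
  apply not_forall_val_lt_four_iff_mul_add hu
    (a₁ + (u : ZMod 8) * (if (0 : ZMod n) = 1 then (1 : ZMod 8) else 0) - if a₂ + 0 = 1 then (1 : ZMod 8) else 0)
  intro s
  have h := hcon (s + (if (0 : ZMod n) = 1 then (1 : ZMod 8) else 0), 0)
  simp only [Prod.mk_add_mk, add_sub_cancel_right] at h
  rw [h]
  have h' : (a₁ + (u : ZMod 8) * (s + if (0 : ZMod n) = 1 then (1 : ZMod 8) else 0) - if a₂ + 0 = 1 then (1 : ZMod 8) else 0) =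
      (u : ZMod 8) * s + (a₁ + (u : ZMod 8) * (if (0 : ZMod n) = 1 then (1 : ZMod 8) else 0) -
        if a₂ + 0 = 1 then (1 : ZMod 8) else 0) := by ring
  rw [h']

/-- **`θ`-asymmetric for `u = 7 = −1`** (`θ(t,v) = (−t, v)`, the dihedral case) when `n ≥ 3`: a symmetry `(a₁, a₂)` would force
`a₁ − 𝟙(v) − 𝟙(a₂ + v) = 3` for every `v`, impossible with three fibres. [folklore] -/
theorem half8_asymmetric_neg (hn : 3 ≤ n) {u : ℕ} (hu : u = 7) (a : ZMod 8 × ZMod n) :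
    ∃ s : ZMod 8 × ZMod n, ¬ ((s.1 - if s.2 = 1 then 1 else 0).val < 4 ↔
      ((a + ((u : ZMod 8) * s.1, s.2)).1 - if (a + ((u : ZMod 8) * s.1, s.2)).2 = 1 then 1 else 0).val < 4) := by
  subst hu
  haveI : Fact (1 < n) := ⟨by omega⟩
  have h01 : (0 : ZMod n) ≠ 1 := zero_ne_one
  have h20 : (2 : ZMod n) ≠ 0 := by
    intro h
    have : ((2 : ℕ) : ZMod n) = 0 := by exact_mod_cast h
    rw [ZMod.natCast_eq_zero_iff] at this
    exact absurd (Nat.le_of_dvd (by norm_num) this) (by omega)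
  have h21 : (2 : ZMod n) ≠ 1 := fun h => one_ne_zero (by linear_combination h : (1 : ZMod n) = 0)
  have h121 : (1 : ZMod n) + 2 ≠ 1 := fun h => h20 (by linear_combination h)
  have h7 : ∀ t : ZMod 8, ((7 : ℕ) : ZMod 8) * t = -t := by decide
  by_contra hcon
  push Not at hcon
  obtain ⟨a₁, a₂⟩ := a
  have key : ∀ v : ZMod n, a₁ - (if v = 1 then (1 : ZMod 8) else 0) - (if a₂ + v = 1 then (1 : ZMod 8) else 0) = 3 := by
    intro v
    rw [← forall_val_lt_four_iff_neg_add]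
    intro s
    have h := hcon (s + (if v = 1 then (1 : ZMod 8) else 0), v)
    simp only [Prod.mk_add_mk, add_sub_cancel_right, h7] at h
    rw [h]
    have h' : (a₁ + -(s + if v = 1 then (1 : ZMod 8) else 0) - if a₂ + v = 1 then (1 : ZMod 8) else 0) =
        -s + (a₁ - (if v = 1 then (1 : ZMod 8) else 0) - if a₂ + v = 1 then (1 : ZMod 8) else 0) := by ring
    rw [h']
  by_cases ha₂ : a₂ = 0
  · subst ha₂
    have h1 := key 1
    rw [if_pos rfl, zero_add, if_pos rfl] at h1
    have h0 := key 0
    rw [if_neg h01, add_zero, if_neg h01] at h0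
    have e1 : a₁ = 5 := by linear_combination h1
    have e0 : a₁ = 3 := by linear_combination h0
    exact absurd (e0.symm.trans e1) (by decide)
  · have hne : a₂ + 1 ≠ (1 : ZMod n) := fun h => ha₂ (by simpa using h)
    have h1 := key 1
    rw [if_pos rfl, if_neg hne] at h1
    have e1 : a₁ = 4 := by linear_combination h1
    by_cases hb : a₂ = 1
    · subst hb
      have h2 := key 2
      rw [if_neg h21, if_neg h121] at h2
      have e2 : a₁ = 3 := by linear_combination h2
      exact absurd (e2.symm.trans e1) (by decide)
    · have hb' : a₂ + 0 ≠ (1 : ZMod n) := by rwa [add_zero]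
      have h0 := key 0
      rw [if_neg h01, if_neg hb'] at h0
      have e0 : a₁ = 3 := by linear_combination h0
      exact absurd (e0.symm.trans e1) (by decide)

end Half

/-! ## §3 The split-involution theorem for `(ℤ/8 ⋊_u C₂) × C_n` -/

section Field

variable {K : Type} [Field K] [NumberField K] [IsCMField K] [IsGalois ℚ K]

/-- **`Gal(K/ℚ) ≅ (ℤ/8 ⋊_u C₂) × C_n`** (`φ(1) = (·)ᵘ`, `u` odd so that `4u = 4`), complex conjugation `(α⁴, 1)`, with an aperiodic
`θ`-asymmetric half of `ℤ/8 × ℤ/n` (`θ(t,v) = (u t, v)`, half given as a decidable predicate) ⟹ **BAD**: a simple DEGENERATE abelian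
variety of dimension `8n` with CM by `K` (doubled type under the split involution `(ξ, 1)`).
[cite: Kubota1965, §2 and §4 Lemma 2] [cite: Shimura1998, §6.2 Thm. 3 and §8.2 Prop. 26] [cite: Gordon1999HodgeAVSurvey, Thm. 6.4 and §9.3] -/
theorem exists_simple_degenerate_semidirectEight_times_cyclic_of_half {n : ℕ} [NeZero n] (u : ℕ) (hu : (u : ZMod 8) * 4 = 4)
    (φ : Multiplicative (ZMod 2) →* MulAut (Multiplicative (ZMod 8))) (hφ : ∀ t, φ (Multiplicative.ofAdd 1) t = t ^ u)
    (e : (K ≃ₐ[ℚ] K) ≃* (Multiplicative (ZMod 8) ⋊[φ] Multiplicative (ZMod 2)) × Multiplicative (ZMod n))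
    (hc : e ((IsCMField.complexConj K).restrictScalars ℚ) = (SemidirectProduct.inl (Multiplicative.ofAdd 4), 1))
    (P : ZMod 8 × ZMod n → Prop) [DecidablePred P] (hP : ∀ s, P s ↔ ¬ P ((4, 0) + s))
    (haper : ∀ a : ZMod 8 × ZMod n, a ≠ 0 → ∃ s, ¬ (P s ↔ P (a + s)))
    (hasym : ∀ a : ZMod 8 × ZMod n, ∃ s, ¬ (P s ↔ P (a + ((u : ZMod 8) * s.1, s.2)))) :
    ∃ (Φ : CMType K) (φ₀ : K →+* ℂ) (X : AbelianVariety ℂ) (ι : 𝓞 K →+* End X)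
      (ϑ : K →+* Module.End ℂ (complexBetti X.X 1)),
      IsPrimitive (ℂ ≃+* ℂ) Φ.1 φ₀ ∧ ¬ IsNondegenerate Φ ∧ IsCMTypeRealisation Φ X ι ϑ ∧ X.IsSimple ∧ X.dim = 8 * n ∧
      ∃ m q : ℕ, ∃ y : complexBetti (⨁ fun _ : Fin m => X).X (2 * q), IsRationalClass y ∧
        IsOfHodgeType (⨁ fun _ : Fin m => X).dim (⨁ fun _ : Fin m => X).X (2 * q) q q y ∧
        y ∉ divisorClassesSpan (⨁ fun _ : Fin m => X).X (⨁ fun _ : Fin m => X).dim q := by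
  classical
  haveI : Fintype (Multiplicative (ZMod 8) ⋊[φ] Multiplicative (ZMod 2)) :=
    Fintype.ofEquiv _ SemidirectProduct.equivProd.symm
  have hcard : Fintype.card (Multiplicative (ZMod 8) ⋊[φ] Multiplicative (ZMod 2)) = 16 := by
    rw [Fintype.card_congr SemidirectProduct.equivProd, Fintype.card_prod, Fintype.card_multiplicative,
      Fintype.card_multiplicative, ZMod.card, ZMod.card]
  set g₁ : Multiplicative (ZMod 2) := Multiplicative.ofAdd 1 with hg₁_def
  have hg₁ : g₁ * g₁ = 1 := by rw [hg₁_def, ← ofAdd_add]; rfl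
  let i : Multiplicative (ZMod 8) × Multiplicative (ZMod n) →*
      (Multiplicative (ZMod 8) ⋊[φ] Multiplicative (ZMod 2)) × Multiplicative (ZMod n) :=
    MonoidHom.prodMap SemidirectProduct.inl (MonoidHom.id _)
  have hi_apply : ∀ t v, i (t, v) = (SemidirectProduct.inl t, v) := fun t v => rfl
  have hi : Function.Injective i := by
    rintro ⟨t, v⟩ ⟨t', v'⟩ h
    simp only [hi_apply, Prod.mk.injEq, SemidirectProduct.inl_inj] at h
    exact Prod.ext h.1 h.2
  set x : (Multiplicative (ZMod 8) ⋊[φ] Multiplicative (ZMod 2)) × Multiplicative (ZMod n) :=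
    (SemidirectProduct.inr g₁, 1) with hx_def
  have hg₁1 : g₁ ≠ 1 := by rw [hg₁_def]; decide
  have hx : ∀ w, i w ≠ x := fun ⟨t, v⟩ h => by
    have h1 := congrArg (fun z => SemidirectProduct.right z.1) h
    simp only [hi_apply, hx_def, SemidirectProduct.right_inl, SemidirectProduct.right_inr] at h1
    exact hg₁1 h1.symm
  have hcov : ∀ g : (Multiplicative (ZMod 8) ⋊[φ] Multiplicative (ZMod 2)) × Multiplicative (ZMod n),
      (∃ w, g = i w) ∨ (∃ w, g = i w * x) := by
    rintro ⟨⟨t, g₂⟩, v⟩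
    rcases (by decide : ∀ z : Multiplicative (ZMod 2), z = 1 ∨ z = Multiplicative.ofAdd 1) g₂ with h | h
    · exact Or.inl ⟨(t, v), by rw [h]; rfl⟩
    · refine Or.inr ⟨(t, v), ?_⟩
      rw [h, hi_apply, hx_def, Prod.mk_mul_mk, mul_one, ← hg₁_def, SemidirectProduct.mk_eq_inl_mul_inr]
  let θ : Multiplicative (ZMod 8) × Multiplicative (ZMod n) ≃* Multiplicative (ZMod 8) × Multiplicative (ZMod n) :=
    MulEquiv.prodCongr (φ g₁) (MulEquiv.refl _)
  have hθ_apply : ∀ w, θ w = (w.1 ^ u, w.2) := fun w => by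
    change (φ g₁ w.1, w.2) = _
    rw [hg₁_def, hφ]
  have hθ : ∀ w, x * i w = i (θ w) * x := fun ⟨t, v⟩ => by
    rw [hi_apply, hx_def, Prod.mk_mul_mk, one_mul, Prod.mk_mul_mk, mul_one]
    refine Prod.ext ?_ rfl
    change SemidirectProduct.inr g₁ * SemidirectProduct.inl t = SemidirectProduct.inl ((φ g₁) t) * SemidirectProduct.inr g₁
    rw [SemidirectProduct.inl_aut, map_inv, inv_mul_cancel_right]
  have hxx : x * x = 1 := by
    rw [hx_def, Prod.mk_mul_mk, mul_one, ← map_mul, hg₁, map_one]; rfl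
  set c : Multiplicative (ZMod 8) × Multiplicative (ZMod n) := (Multiplicative.ofAdd 4, 1) with hc_def
  have hic : i c = (SemidirectProduct.inl (Multiplicative.ofAdd 4), 1) := rfl
  have h4 : Multiplicative.ofAdd (4 : ZMod 8) ≠ 1 := by decide
  have h44 : Multiplicative.ofAdd ((4 : ZMod 8) + 4) = 1 := by decide
  have hc1 : c ≠ 1 := by rw [hc_def]; exact fun h => h4 (congrArg Prod.fst h)
  have hcc : c * c = 1 := by
    rw [hc_def, Prod.mk_mul_mk, mul_one, ← ofAdd_add, h44]; rfl
  have hθc : θ c = c := by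
    rw [hθ_apply, hc_def]
    refine Prod.ext ?_ rfl
    change Multiplicative.ofAdd (4 : ZMod 8) ^ u = Multiplicative.ofAdd 4
    rw [← ofAdd_nsmul, nsmul_eq_mul, hu]
  set S : Finset (Multiplicative (ZMod 8) × Multiplicative (ZMod n)) :=
    Finset.univ.filter fun w => P (Multiplicative.toAdd w.1, Multiplicative.toAdd w.2) with hS_def
  have hSmem : ∀ w : Multiplicative (ZMod 8) × Multiplicative (ZMod n),
      w ∈ S ↔ P (Multiplicative.toAdd w.1, Multiplicative.toAdd w.2) := fun w => by simp [hS_def]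
  have hS : ∀ a, a ∈ S ↔ c * a ∉ S := fun a => by
    rw [hSmem, hSmem, hc_def, Prod.fst_mul, Prod.snd_mul, one_mul, toAdd_mul, toAdd_ofAdd, hP]
    simp only [Prod.mk_add_mk, zero_add]
  have haper' : ∀ a : Multiplicative (ZMod 8) × Multiplicative (ZMod n), a ≠ 1 → ∃ s, ¬ (s ∈ S ↔ a * s ∈ S) := by
    intro a ha
    have ha' : (Multiplicative.toAdd a.1, Multiplicative.toAdd a.2) ≠ (0 : ZMod 8 × ZMod n) := by
      intro h
      apply ha
      rw [Prod.mk_eq_zero] at h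
      exact Prod.ext (toAdd_eq_zero.1 h.1) (toAdd_eq_zero.1 h.2)
    obtain ⟨⟨s₁, s₂⟩, hs⟩ := haper _ ha'
    refine ⟨(Multiplicative.ofAdd s₁, Multiplicative.ofAdd s₂), ?_⟩
    simpa only [hSmem, Prod.fst_mul, Prod.snd_mul, toAdd_mul, toAdd_ofAdd, Prod.mk_add_mk] using hs
  have hasym' : ∀ a : Multiplicative (ZMod 8) × Multiplicative (ZMod n), ∃ s, ¬ (s ∈ S ↔ a * θ s ∈ S) := by
    intro a
    obtain ⟨⟨s₁, s₂⟩, hs⟩ := hasym (Multiplicative.toAdd a.1, Multiplicative.toAdd a.2)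
    refine ⟨(Multiplicative.ofAdd s₁, Multiplicative.ofAdd s₂), ?_⟩
    simpa only [hSmem, hθ_apply, Prod.fst_mul, Prod.snd_mul, toAdd_mul, toAdd_ofAdd, toAdd_pow, nsmul_eq_mul,
      Prod.mk_add_mk] using hs
  obtain ⟨Φ, φ₀, X, ι, ϑ, h1, h2, h3, h4, h5, h6⟩ := exists_simple_degenerate_of_split_involution e i hi x hx hcov θ hθ hxx hc1
    hcc hθc (by rw [hic]; exact hc) S hS haper' hasym'
  refine ⟨Φ, φ₀, X, ι, ϑ, h1, h2, h3, h4, ?_, h6⟩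
  rw [h5, Fintype.card_prod, hcard, Fintype.card_multiplicative, ZMod.card]
  omega

/-! ## §4 `SD₁₆ × C_n`, `M₁₆ × C_n` (every `n`) and `D₈ × C_n` (`n ≥ 3`) are BAD -/

/-- **`Gal(K/ℚ) ≅ SD₁₆ × C_n` (`u = 3`) or `M₁₆ × C_n` (`u = 5`), complex conjugation `(α⁴, 1)`, ANY `n ≥ 1` ⟹ `K` is BAD**:
a PRIMITIVE DEGENERATE CM type realised by a SIMPLE abelian variety of dimension `8n` with CM by `K` carrying a rational `(q,q)`
class outside the divisor ring on some power (doubled type of the half `t − 𝟙_{v=1}(v) ∈ {0,1,2,3}`).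
[cite: Kubota1965, §2 and §4 Lemma 2] [cite: Shimura1998, §6.2 Thm. 3 and §8.2 Prop. 26] [cite: Gordon1999HodgeAVSurvey, Thm. 6.4 and §9.3] -/
theorem exists_simple_degenerate_semidihedral_or_modular_times_cyclic {n : ℕ} [NeZero n] {u : ℕ} (hu : u = 3 ∨ u = 5)
    (φ : Multiplicative (ZMod 2) →* MulAut (Multiplicative (ZMod 8))) (hφ : ∀ t, φ (Multiplicative.ofAdd 1) t = t ^ u)
    (e : (K ≃ₐ[ℚ] K) ≃* (Multiplicative (ZMod 8) ⋊[φ] Multiplicative (ZMod 2)) × Multiplicative (ZMod n))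
    (hc : e ((IsCMField.complexConj K).restrictScalars ℚ) = (SemidirectProduct.inl (Multiplicative.ofAdd 4), 1)) :
    ∃ (Φ : CMType K) (φ₀ : K →+* ℂ) (X : AbelianVariety ℂ) (ι : 𝓞 K →+* End X)
      (ϑ : K →+* Module.End ℂ (complexBetti X.X 1)),
      IsPrimitive (ℂ ≃+* ℂ) Φ.1 φ₀ ∧ ¬ IsNondegenerate Φ ∧ IsCMTypeRealisation Φ X ι ϑ ∧ X.IsSimple ∧ X.dim = 8 * n ∧
      ∃ m q : ℕ, ∃ y : complexBetti (⨁ fun _ : Fin m => X).X (2 * q), IsRationalClass y ∧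
        IsOfHodgeType (⨁ fun _ : Fin m => X).dim (⨁ fun _ : Fin m => X).X (2 * q) q q y ∧
        y ∉ divisorClassesSpan (⨁ fun _ : Fin m => X).X (⨁ fun _ : Fin m => X).dim q :=
  exists_simple_degenerate_semidirectEight_times_cyclic_of_half u (by rcases hu with rfl | rfl <;> decide) φ hφ e hc
    (fun s => (s.1 - if s.2 = 1 then 1 else 0).val < 4) half8_cm half8_aperiodic (half8_asymmetric_mul hu)

/-- **`Gal(K/ℚ) ≅ D₈ × C_n` presented as `(ℤ/8 ⋊₋₁ C₂) × C_n` (`u = 7`), complex conjugation `(α⁴, 1)`, `n ≥ 3` ⟹ `K` is BAD**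
(same doubled type; `D₈` alone is GOOD — every half of `ℤ/8` is reflection-symmetric — and the third fibre breaks the symmetry).
[cite: Kubota1965, §2 and §4 Lemma 2] [cite: Shimura1998, §6.2 Thm. 3 and §8.2 Prop. 26] [cite: Gordon1999HodgeAVSurvey, Thm. 6.4 and §9.3] -/
theorem exists_simple_degenerate_dihedralEight_times_cyclic {n : ℕ} [NeZero n] (hn : 3 ≤ n) {u : ℕ} (hu : u = 7)
    (φ : Multiplicative (ZMod 2) →* MulAut (Multiplicative (ZMod 8))) (hφ : ∀ t, φ (Multiplicative.ofAdd 1) t = t ^ u)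
    (e : (K ≃ₐ[ℚ] K) ≃* (Multiplicative (ZMod 8) ⋊[φ] Multiplicative (ZMod 2)) × Multiplicative (ZMod n))
    (hc : e ((IsCMField.complexConj K).restrictScalars ℚ) = (SemidirectProduct.inl (Multiplicative.ofAdd 4), 1)) :
    ∃ (Φ : CMType K) (φ₀ : K →+* ℂ) (X : AbelianVariety ℂ) (ι : 𝓞 K →+* End X)
      (ϑ : K →+* Module.End ℂ (complexBetti X.X 1)),
      IsPrimitive (ℂ ≃+* ℂ) Φ.1 φ₀ ∧ ¬ IsNondegenerate Φ ∧ IsCMTypeRealisation Φ X ι ϑ ∧ X.IsSimple ∧ X.dim = 8 * n ∧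
      ∃ m q : ℕ, ∃ y : complexBetti (⨁ fun _ : Fin m => X).X (2 * q), IsRationalClass y ∧
        IsOfHodgeType (⨁ fun _ : Fin m => X).dim (⨁ fun _ : Fin m => X).X (2 * q) q q y ∧
        y ∉ divisorClassesSpan (⨁ fun _ : Fin m => X).X (⨁ fun _ : Fin m => X).dim q :=
  exists_simple_degenerate_semidirectEight_times_cyclic_of_half u (by subst hu; decide) φ hφ e hc
    (fun s => (s.1 - if s.2 = 1 then 1 else 0).val < 4) half8_cm half8_aperiodic (half8_asymmetric_neg hn hu)

end Field

end Summit.HodgeConjecture.CorCM.SplitInvolution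

end
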